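import Mathlib.RepresentationTheory.Homological.TateCohomology.Basic
import Mathlib.RepresentationTheory.Homological.GroupCohomology.LowDegree
import Mathlib.Algebra.Homology.ConcreteCategory
import HarnessLib

/-!
# Explicit classes in `Ĥ¹(G, M) = H¹(G, M)` and `Ĥ²(G, M) = H²(G, M)`: the class of a
# `1`- or `2`-cocycle and Mathlib's identifications `Ĥⁿ ≅ Hⁿ` (`n ≥ 1`) on classes
# (Serre, *Local Fields* VIII §1; Brown VI §4) — on Mathlib's `tateCohomology`

Topic `Algebra/Homology`; namespace `Literature.Algebra.Homology.Tate`.  Mathlib-only imports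
(`tateCohomology`, `TateCohomology.isoGroupCohomology`, the low-degree cocycle API `cocycles₁`,
`cocycles₂`, `H1π`, `H2π`); definitions with bodies (the explicit classes) and theorems; NO named
fact, no `sorry`.  Lane `lit-hodgefound` (Track 2 foundations library), seat p30 gen 19, row
g19-#11 of `run/shared/lean/pub/lit-hodgefound/SKELETON.md`; positive-degree twin of g19-#7
`TateCohomologyNegTwoClasses` (`Ĥ⁻² ≅ H₁` on classes).

Source followed.  J.-P. Serre, *Local Fields*, GTM 67 (1979), VIII §1 [held copy
`book:serre1979-local-fields`, chunk p0117]: the modified (Tate) cohomology groups agree with the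
ordinary ones in positive degrees, "`Ĥⁿ(G, A) = Hⁿ(G, A)` for `n ≥ 1`"; K. S. Brown, *Cohomology
of Groups* (1982), VI §4 (complete resolutions; `Ĥⁿ = Hⁿ` for `n > 0`) [Brown1982CohomologyGroups].
In Mathlib, `tateCohomology M n` (`n ≥ 0`) is the homology of the Tate complex `tateComplex M`,
whose non-negative part IS the complex of inhomogeneous cochains; the identification with
`groupCohomology M n` for `n ≥ 1` is `TateCohomology.isoGroupCohomology n` (a restriction-of-
embedding isomorphism).  This file names the classes `oneClass M f ∈ Ĥ¹(G, M)`,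
`twoClass M f ∈ Ĥ²(G, M)` of cocycles `f ∈ Z¹(G, M)`, `Z²(G, M)` (Mathlib's `cocycles₁ M ⊆ G → M`,
`cocycles₂ M ⊆ G × G → M`) and evaluates these identifications on them: `[f] ↦ H1π M f`,
`[f] ↦ H2π M f`.

## What is formalised (`k` a commutative ring, `G` a finite group, `M : Rep k G`)

* §1 `Tate.cochain₁`, `Tate.cocycles₁ToCycles`, **`Tate.oneClass M : Z¹(G, M) → Ĥ¹(G, M)`**;
  **`isoGroupCohomology_app_hom_oneClass`** (`Ĥ¹ ≅ H¹` sends `[f] ↦ H1π M f`),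
  `oneClass_surjective`, `oneClass_eq_zero_iff` (`[f] = 0 ↔ f ∈ B¹`), `oneClass_eq_iff`.
* §2 `Tate.cochain₂`, `Tate.cocycles₂ToCycles`, **`Tate.twoClass M : Z²(G, M) → Ĥ²(G, M)`**;
  **`isoGroupCohomology_app_hom_twoClass`** (`Ĥ² ≅ H²` sends `[f] ↦ H2π M f`),
  `twoClass_surjective`, `twoClass_eq_zero_iff`, `twoClass_eq_iff`.

## References
* J.-P. Serre, *Local Fields*, GTM 67, Springer (1979), VIII §1. [Serre1979]
* K. S. Brown, *Cohomology of Groups*, GTM 87, Springer (1982), VI §4. [Brown1982CohomologyGroups]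
-/

noncomputable section

open CategoryTheory CategoryTheory.Limits groupCohomology

universe u

namespace Literature.Algebra.Homology

namespace Tate

variable {k G : Type u} [CommRing k] [Group G] [Fintype G] (M : Rep.{u} k G)

/-! ## §1 Classes in `Ĥ¹(G, M)` -/

/-- The `1`-cochain of the Tate complex attached to `f : G → M` (`C¹(G, M) ≅ (G → M)`).
[cite: Brown1982CohomologyGroups, VI §4] -/
abbrev cochain₁ (f : G → M.V) : (tateComplex M).X 1 := (cochainsIso₁ M).inv f

/-- A `1`-cocycle is a `1`-cocycle of the Tate complex (`d¹ = d₁₂` read through `C¹ ≅ (G → M)`,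
`C² ≅ (G × G → M)`). [cite: Brown1982CohomologyGroups, VI §4] -/
theorem tateComplex_d_cochain₁ (f : cocycles₁ M) :
    (tateComplex M).d 1 2 (cochain₁ M (f : G → M.V)) = 0 := by
  change ((cochainsIso₁ M).inv ≫ (inhomogeneousCochains M).d 1 2) (f : G → M.V) =
    (0 : (inhomogeneousCochains M).X 2)
  rw [eq_d₁₂_comp_inv, ModuleCat.comp_apply,
    show d₁₂ M (f : G → M.V) = 0 from LinearMap.mem_ker.1 f.2, map_zero]

/-- **`Z¹(G, M) ⟶ Z¹(tateComplex M)`.** [cite: Brown1982CohomologyGroups, VI §4] -/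
def cocycles₁ToCycles : ModuleCat.of k (cocycles₁ M) ⟶ (tateComplex M).cycles 1 :=
  (tateComplex M).liftCycles (ModuleCat.ofHom (cocycles₁ M).subtype ≫ (cochainsIso₁ M).inv) 2
    (by simp) (by
      ext f
      change (tateComplex M).d 1 2 (cochain₁ M (f : G → M.V)) = 0
      exact tateComplex_d_cochain₁ M f)

/-- `(Z¹ ⟶ Z¹(tate)) ≫ (Z¹(tate) ⟶ C¹) = (Z¹ ⊆ (G → M) ≅ C¹)`. [cite: Brown1982CohomologyGroups, VI §4] -/
@[reassoc (attr := simp)]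
theorem cocycles₁ToCycles_i :
    cocycles₁ToCycles M ≫ (tateComplex M).iCycles 1 =
      ModuleCat.ofHom (cocycles₁ M).subtype ≫ (cochainsIso₁ M).inv :=
  (tateComplex M).liftCycles_i _ _ _ _

/-- **The class map `Z¹(G, M) ⟶ Ĥ¹(G, M)`, `f ↦ [f]`.** [cite: Serre1979, VIII §1][cite: Brown1982CohomologyGroups, VI §4] -/
def oneClassHom : ModuleCat.of k (cocycles₁ M) ⟶ tateCohomology M 1 :=
  cocycles₁ToCycles M ≫ (tateComplex M).homologyπ 1

/-- **The class `[f] ∈ Ĥ¹(G, M)` of a `1`-cocycle `f`.** [cite: Serre1979, VIII §1][cite: Brown1982CohomologyGroups, VI §4] -/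
abbrev oneClass (f : cocycles₁ M) : tateCohomology M 1 := oneClassHom M f

/-- `[f]` is the class of the cocycle `f`. [cite: Brown1982CohomologyGroups, VI §4] -/
theorem iCycles_cocycles₁ToCycles (f : cocycles₁ M) :
    (tateComplex M).iCycles 1 (cocycles₁ToCycles M f) = cochain₁ M (f : G → M.V) := by
  rw [← ModuleCat.comp_apply, cocycles₁ToCycles_i]
  rfl

/-- **Mathlib's `Ĥ¹(G, M) ≅ H¹(G, M)` (`TateCohomology.isoGroupCohomology 1`) sends the class `[f]`
of a `1`-cocycle to its cohomology class `H1π M f`.** [cite: Serre1979, VIII §1 ("`Ĥⁿ(G, A) =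
Hⁿ(G, A)` for `n ≥ 1`")][cite: Brown1982CohomologyGroups, VI §4] -/
theorem isoGroupCohomology_app_hom_oneClass (f : cocycles₁ M) :
    ((TateCohomology.isoGroupCohomology 1).app M).hom (oneClass M f) = H1π M f := by
  change ((tateComplexConnectData M).homologyIsoPos 1 ((1 : ℕ) : ℤ) rfl).hom
      ((tateComplex M).homologyπ 1 (cocycles₁ToCycles M f)) =
    (inhomogeneousCochains M).homologyπ 1 ((isoCocycles₁ M).inv f)
  dsimp only [CochainComplex.ConnectData.homologyIsoPos, Iso.trans, Iso.symm,
    HomologicalComplex.homologyMapIso]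
  rw [ModuleCat.comp_apply, ← ModuleCat.comp_apply ((tateComplex M).homologyπ 1),
    HomologicalComplex.homologyπ_restrictionHomologyIso_inv, ModuleCat.comp_apply,
    ← ModuleCat.comp_apply ((HomologicalComplex.restriction _ _).homologyπ 1),
    HomologicalComplex.homologyπ_naturality, ModuleCat.comp_apply]
  congr 1
  apply (ModuleCat.mono_iff_injective ((inhomogeneousCochains M).iCycles 1)).1 inferInstance
  rw [← ModuleCat.comp_apply _ ((inhomogeneousCochains M).iCycles 1), HomologicalComplex.cyclesMap_i,
    ModuleCat.comp_apply, ← ModuleCat.comp_apply _ ((HomologicalComplex.restriction _ _).iCycles 1),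
    HomologicalComplex.restrictionCyclesIso_inv_iCycles, ModuleCat.comp_apply,
    CochainComplex.ConnectData.restrictionGEIso_hom_f]
  erw [Iso.inv_hom_id_apply]
  rw [iCycles_cocycles₁ToCycles]
  change cochain₁ M (f : G → M.V) = iCocycles M 1 ((isoCocycles₁ M).inv f)
  rw [isoCocycles₁_inv_comp_iCocycles_apply]
  rfl

/-- Every class of `Ĥ¹(G, M)` is `[f]` for some `1`-cocycle `f`. [cite: Brown1982CohomologyGroups, VI §4] -/
theorem oneClass_surjective : Function.Surjective (oneClass M) := fun c => by
  obtain ⟨f, hf⟩ := (ModuleCat.epi_iff_surjective (H1π M)).1 inferInstance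
    (((TateCohomology.isoGroupCohomology 1).app M).hom c)
  refine ⟨f, (ModuleCat.mono_iff_injective
    ((TateCohomology.isoGroupCohomology 1).app M).hom).1 inferInstance ?_⟩
  rw [isoGroupCohomology_app_hom_oneClass, hf]

/-- **`[f] = 0` in `Ĥ¹(G, M)` iff `f` is a `1`-coboundary.** [cite: Serre1979, VIII §1][cite: Brown1982CohomologyGroups, VI §4] -/
theorem oneClass_eq_zero_iff (f : cocycles₁ M) :
    oneClass M f = 0 ↔ (f : G → M.V) ∈ coboundaries₁ M := by
  rw [← ((ModuleCat.mono_iff_injective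
      ((TateCohomology.isoGroupCohomology 1).app M).hom).1 inferInstance).eq_iff,
    map_zero, isoGroupCohomology_app_hom_oneClass]
  exact H1π_eq_zero_iff f

/-- `[f] = [f']` in `Ĥ¹(G, M)` iff `f - f'` is a `1`-coboundary. [cite: Brown1982CohomologyGroups, VI §4] -/
theorem oneClass_eq_iff (f f' : cocycles₁ M) :
    oneClass M f = oneClass M f' ↔ (f : G → M.V) - f' ∈ coboundaries₁ M := by
  rw [← sub_eq_zero, ← map_sub, oneClass_eq_zero_iff]
  rfl

/-! ## §2 Classes in `Ĥ²(G, M)` -/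

/-- The `2`-cochain of the Tate complex attached to `f : G × G → M` (`C²(G, M) ≅ (G × G → M)`).
[cite: Brown1982CohomologyGroups, VI §4] -/
abbrev cochain₂ (f : G × G → M.V) : (tateComplex M).X 2 := (cochainsIso₂ M).inv f

/-- A `2`-cocycle is a `2`-cocycle of the Tate complex. [cite: Brown1982CohomologyGroups, VI §4] -/
theorem tateComplex_d_cochain₂ (f : cocycles₂ M) :
    (tateComplex M).d 2 3 (cochain₂ M (f : G × G → M.V)) = 0 := by
  change ((cochainsIso₂ M).inv ≫ (inhomogeneousCochains M).d 2 3) (f : G × G → M.V) =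
    (0 : (inhomogeneousCochains M).X 3)
  rw [eq_d₂₃_comp_inv, ModuleCat.comp_apply,
    show d₂₃ M (f : G × G → M.V) = 0 from LinearMap.mem_ker.1 f.2, map_zero]

/-- **`Z²(G, M) ⟶ Z²(tateComplex M)`.** [cite: Brown1982CohomologyGroups, VI §4] -/
def cocycles₂ToCycles : ModuleCat.of k (cocycles₂ M) ⟶ (tateComplex M).cycles 2 :=
  (tateComplex M).liftCycles (ModuleCat.ofHom (cocycles₂ M).subtype ≫ (cochainsIso₂ M).inv) 3
    (by simp) (by
      ext f
      change (tateComplex M).d 2 3 (cochain₂ M (f : G × G → M.V)) = 0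
      exact tateComplex_d_cochain₂ M f)

/-- `(Z² ⟶ Z²(tate)) ≫ (Z²(tate) ⟶ C²) = (Z² ⊆ (G × G → M) ≅ C²)`. [cite: Brown1982CohomologyGroups, VI §4] -/
@[reassoc (attr := simp)]
theorem cocycles₂ToCycles_i :
    cocycles₂ToCycles M ≫ (tateComplex M).iCycles 2 =
      ModuleCat.ofHom (cocycles₂ M).subtype ≫ (cochainsIso₂ M).inv :=
  (tateComplex M).liftCycles_i _ _ _ _

/-- **The class map `Z²(G, M) ⟶ Ĥ²(G, M)`, `f ↦ [f]`.** [cite: Serre1979, VIII §1][cite: Brown1982CohomologyGroups, VI §4] -/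
def twoClassHom : ModuleCat.of k (cocycles₂ M) ⟶ tateCohomology M 2 :=
  cocycles₂ToCycles M ≫ (tateComplex M).homologyπ 2

/-- **The class `[f] ∈ Ĥ²(G, M)` of a `2`-cocycle `f`.** [cite: Serre1979, VIII §1][cite: Brown1982CohomologyGroups, VI §4] -/
abbrev twoClass (f : cocycles₂ M) : tateCohomology M 2 := twoClassHom M f

/-- `[f]` is the class of the cocycle `f`. [cite: Brown1982CohomologyGroups, VI §4] -/
theorem iCycles_cocycles₂ToCycles (f : cocycles₂ M) :
    (tateComplex M).iCycles 2 (cocycles₂ToCycles M f) = cochain₂ M (f : G × G → M.V) := by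
  rw [← ModuleCat.comp_apply, cocycles₂ToCycles_i]
  rfl

/-- **Mathlib's `Ĥ²(G, M) ≅ H²(G, M)` (`TateCohomology.isoGroupCohomology 2`) sends the class `[f]`
of a `2`-cocycle to its cohomology class `H2π M f`.** [cite: Serre1979, VIII §1][cite: Brown1982CohomologyGroups, VI §4] -/
theorem isoGroupCohomology_app_hom_twoClass (f : cocycles₂ M) :
    ((TateCohomology.isoGroupCohomology 2).app M).hom (twoClass M f) = H2π M f := by
  change ((tateComplexConnectData M).homologyIsoPos 2 ((2 : ℕ) : ℤ) rfl).hom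
      ((tateComplex M).homologyπ 2 (cocycles₂ToCycles M f)) =
    (inhomogeneousCochains M).homologyπ 2 ((isoCocycles₂ M).inv f)
  dsimp only [CochainComplex.ConnectData.homologyIsoPos, Iso.trans, Iso.symm,
    HomologicalComplex.homologyMapIso]
  rw [ModuleCat.comp_apply, ← ModuleCat.comp_apply ((tateComplex M).homologyπ 2),
    HomologicalComplex.homologyπ_restrictionHomologyIso_inv, ModuleCat.comp_apply,
    ← ModuleCat.comp_apply ((HomologicalComplex.restriction _ _).homologyπ 2),
    HomologicalComplex.homologyπ_naturality, ModuleCat.comp_apply]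
  congr 1
  apply (ModuleCat.mono_iff_injective ((inhomogeneousCochains M).iCycles 2)).1 inferInstance
  rw [← ModuleCat.comp_apply _ ((inhomogeneousCochains M).iCycles 2), HomologicalComplex.cyclesMap_i,
    ModuleCat.comp_apply, ← ModuleCat.comp_apply _ ((HomologicalComplex.restriction _ _).iCycles 2),
    HomologicalComplex.restrictionCyclesIso_inv_iCycles, ModuleCat.comp_apply,
    CochainComplex.ConnectData.restrictionGEIso_hom_f]
  erw [Iso.inv_hom_id_apply]
  rw [iCycles_cocycles₂ToCycles]
  change cochain₂ M (f : G × G → M.V) = iCocycles M 2 ((isoCocycles₂ M).inv f)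
  rw [isoCocycles₂_inv_comp_iCocycles_apply]
  rfl

/-- Every class of `Ĥ²(G, M)` is `[f]` for some `2`-cocycle `f`. [cite: Brown1982CohomologyGroups, VI §4] -/
theorem twoClass_surjective : Function.Surjective (twoClass M) := fun c => by
  obtain ⟨f, hf⟩ := (ModuleCat.epi_iff_surjective (H2π M)).1 inferInstance
    (((TateCohomology.isoGroupCohomology 2).app M).hom c)
  refine ⟨f, (ModuleCat.mono_iff_injective
    ((TateCohomology.isoGroupCohomology 2).app M).hom).1 inferInstance ?_⟩
  rw [isoGroupCohomology_app_hom_twoClass, hf]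

/-- **`[f] = 0` in `Ĥ²(G, M)` iff `f` is a `2`-coboundary.** [cite: Serre1979, VIII §1][cite: Brown1982CohomologyGroups, VI §4] -/
theorem twoClass_eq_zero_iff (f : cocycles₂ M) :
    twoClass M f = 0 ↔ (f : G × G → M.V) ∈ coboundaries₂ M := by
  rw [← ((ModuleCat.mono_iff_injective
      ((TateCohomology.isoGroupCohomology 2).app M).hom).1 inferInstance).eq_iff,
    map_zero, isoGroupCohomology_app_hom_twoClass]
  exact H2π_eq_zero_iff f

/-- `[f] = [f']` in `Ĥ²(G, M)` iff `f - f'` is a `2`-coboundary. [cite: Brown1982CohomologyGroups, VI §4] -/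
theorem twoClass_eq_iff (f f' : cocycles₂ M) :
    twoClass M f = twoClass M f' ↔ (f : G × G → M.V) - f' ∈ coboundaries₂ M := by
  rw [← sub_eq_zero, ← map_sub, twoClass_eq_zero_iff]
  rfl

end Tate

end Literature.Algebra.Homology
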